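import Mathlib
import Summits.Ventures.PercRepro2.CoinPin
import Summits.Ventures.PercRepro2.CoinPreHead

/-!
# The pre-head reduction with a SEMANTIC unreachability hypothesis, and pre-head CHAINS (blind cell
PercRepro2, night-2 g6; proofs/NIGHT2-DARC.md §29.11)

`darc_of_preHead` asks that no coin has an arc into `w`.  What its proof uses is only that `w` is
never reached from `s` — `∀ ω, ¬ Reach arcs ω s w`.  With that hypothesis (`darc_of_preHead_unr`)
the reduction composes along a CHAIN of random arcs `w → w₁ → v₀` (`darc_of_preHead_chain₂`):
`w` is unreachable, and `w₁`, whose only in-arc comes from `w`, is unreachable too; pinning the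
first arm open makes the gate `u → w` the gate `u → w₁`, pinning the second makes it the gate
`u → v₀`.  So a random pre-head PATH of any length into a head of a landed theorem is a theorem
(two steps written out; the pattern iterates).
-/

namespace Summit.Ventures.PercRepro2.Coin

open Classical

section Unreachable

variable {V : Type*} {E : Type*}

/-- Reachability from `s` is unchanged by the state of a coin all of whose arcs leave a vertex `w`
that `s` never reaches. -/
lemma reach_of_reach_of_unreachable {arcs : E → Finset (V × V)} {s w : V}
    (hunr : ∀ ω : Config E, ¬ Reach arcs ω s w) {e : E} (he : ∀ xy ∈ arcs e, xy.1 = w)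
    {ω ω' : Config E} (hωω' : ∀ e' ∈ ({e}ᶜ : Set E), ω e' = ω' e') {y : V}
    (h : Reach arcs ω s y) : Reach arcs ω' s y := by
  induction h with
  | refl => exact reach_refl _ _ _
  | tail hxy hstep ih =>
    obtain ⟨e', he', hmem⟩ := hstep
    refine reach_trans ih (reach_of_openArc ⟨e', ?_, hmem⟩)
    by_cases hee : e' = e
    · subst hee
      exact absurd (he _ hmem ▸ hxy) (hunr ω)
    · rw [← hωω' e' (by simpa using hee)]
      exact he'

/-- The avoidance event does not see such a coin. -/
lemma dependsOn_avoidEvent_of_unreachable {arcs : E → Finset (V × V)} {s w : V}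
    (hunr : ∀ ω : Config E, ¬ Reach arcs ω s w) {e : E} (he : ∀ xy ∈ arcs e, xy.1 = w)
    (T : Finset V) : DependsOn (· ∈ avoidEvent arcs s T) ({e}ᶜ : Set E) := by
  intro ω ω' hωω'
  simp only [avoidEvent, Set.mem_setOf_eq]
  apply propext
  constructor
  · intro h t ht hr
    exact h t ht (reach_of_reach_of_unreachable hunr he (fun e' he' => (hωω' e' he').symm) hr)
  · intro h t ht hr
    exact h t ht (reach_of_reach_of_unreachable hunr he hωω' hr)

/-- A marker does not see such a coin. -/
lemma dependsOn_marker_of_unreachable {R : Type*} [CommRing R] {arcs : E → Finset (V × V)}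
    {s w : V} (hunr : ∀ ω : Config E, ¬ Reach arcs ω s w) {e : E} (he : ∀ xy ∈ arcs e, xy.1 = w)
    (a : V) : DependsOn (marker (R := R) arcs s a) ({e}ᶜ : Set E) := by
  intro ω ω' hωω'
  simp only [marker]
  have hiff : Reach arcs ω s a ↔ Reach arcs ω' s a :=
    ⟨reach_of_reach_of_unreachable hunr he hωω',
      reach_of_reach_of_unreachable hunr he (fun e' he' => (hωω' e' he').symm)⟩
  simp only [hiff]

/-- A vertex whose only in-arcs come from an unreachable vertex is unreachable. -/
lemma unreachable_of_in_from_unreachable {arcs : E → Finset (V × V)} {s w w₁ : V}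
    (hunr : ∀ ω : Config E, ¬ Reach arcs ω s w) (hs : s ≠ w₁)
    (hin : ∀ e, ∀ xy ∈ arcs e, xy.2 = w₁ → xy.1 = w) : ∀ ω : Config E, ¬ Reach arcs ω s w₁ := by
  intro ω h
  rcases Relation.ReflTransGen.cases_tail h with h | ⟨x, hsx, ⟨e, _, hmem⟩⟩
  · exact hs h.symm
  · have hx : x = w := hin e _ hmem rfl
    subst hx
    exact hunr ω hsx

end Unreachable

section Theorem

variable {V : Type*} {E : Type*} [Fintype V] [DecidableEq V] [Fintype E] [DecidableEq E]
  {R : Type*} [CommRing R] [LinearOrder R] [IsStrictOrderedRing R]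

/-- **The pre-head reduction with the semantic hypothesis.** -/
theorem darc_of_preHead_unr (p : E → R) (hp : IsProbVec p) {arcs : E → Finset (V × V)}
    (hS : SameEnds arcs) (s : V) (T : Finset V) (a b u w v₀ : V) (e : E)
    (he : arcs e = {(w, v₀)}) (hunr : ∀ ω : Config E, ¬ Reach arcs ω s w)
    (hout : ∀ e', (∃ xy ∈ arcs e', xy.1 = w) → e' = e) (hwT : w ∉ T)
    (hsure : DARC (Function.update p e 1) arcs s T a b u v₀) :
    DARC p arcs s T a b u w := by
  have he' : ∀ xy ∈ arcs e, xy.1 = w := fun xy hxy => by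
    rw [he, Finset.mem_singleton] at hxy
    subst hxy
    rfl
  refine darc_of_pin_of_dependsOn p arcs s T a b u w e (hp.nonneg e) (hp.le_one e)
    (dependsOn_avoidEvent_of_unreachable hunr he' T)
    (dependsOn_marker_of_unreachable hunr he' a) (dependsOn_marker_of_unreachable hunr he' b)
    ?_ ?_
  · unfold DARC at hsure ⊢
    rw [phiC_congr_of_sure (Function.update p e 1) arcs s T a b (e := e) (by simp)
      (fun ω hω => gateEvent_iff_of_sureArc he hout s hwT u hω)]
    exact hsure
  · unfold DARC
    rw [phiC_congr_of_null (Function.update p e 0) arcs s T a b (e := e) (by simp)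
      (fun ω hω => gateEvent_iff_of_closedArc hout s hwT u hω), phiC_avoidEvent]
    exact mul_nonneg (prob_nonneg (isProbVec_update_zero hp e) _)
      (covC_nonneg _ (isProbVec_update_zero hp e) hS s a b T)

/-- **A pre-head CHAIN of two random arcs** `w → w₁ → v₀`: `w` unentered, `w₁` entered only from
`w`, each with its arc as its only out-coin; row 2′DARC at `u → w` follows from the row at
`u → v₀` with both arcs pinned open. -/
theorem darc_of_preHead_chain₂ (p : E → R) (hp : IsProbVec p) {arcs : E → Finset (V × V)}
    (hS : SameEnds arcs) (s : V) (T : Finset V) (a b u w w₁ v₀ : V) (e e₁ : E)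
    (he : arcs e = {(w, w₁)}) (he₁ : arcs e₁ = {(w₁, v₀)})
    (hin : ∀ e', ∀ xy ∈ arcs e', xy.2 ≠ w) (hin₁ : ∀ e', ∀ xy ∈ arcs e', xy.2 = w₁ → xy.1 = w)
    (hout : ∀ e', (∃ xy ∈ arcs e', xy.1 = w) → e' = e)
    (hout₁ : ∀ e', (∃ xy ∈ arcs e', xy.1 = w₁) → e' = e₁) (hs : s ≠ w) (hs₁ : s ≠ w₁)
    (hwT : w ∉ T) (hw₁T : w₁ ∉ T)
    (hsure : DARC (Function.update (Function.update p e 1) e₁ 1) arcs s T a b u v₀) :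
    DARC p arcs s T a b u w := by
  have hunr : ∀ ω : Config E, ¬ Reach arcs ω s w := fun ω h =>
    (ne_of_reach_of_noIn hin hs h) rfl
  have hunr₁ : ∀ ω : Config E, ¬ Reach arcs ω s w₁ :=
    unreachable_of_in_from_unreachable hunr hs₁ hin₁
  refine darc_of_preHead_unr p hp hS s T a b u w w₁ e he hunr hout hwT ?_
  exact darc_of_preHead_unr (Function.update p e 1) (isProbVec_update_one hp e) hS s T a b u w₁ v₀
    e₁ he₁ hunr₁ hout₁ hw₁T hsure

end Theorem

end Summit.Ventures.PercRepro2.Coin
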